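import Summits.RiemannHypothesis.RiemannHypothesis.Theorems.HardyZLehmerSplitDictionaryFarFieldShellsUp
import HarnessLib

/-!
# Stub B of crux `Dictionary` (route `HardyZLehmerSplit`, stmt-RiemannHypothesis-24248): the explicit far field

`StubFarField.stub_farField : ∀ t : ℝ, 100 ≤ t → |farSum t| ≤ 20 * Real.log t + 50` — the registered
stub `Summit.RiemannHypothesis.RiemannHypothesis.Cruxes.Dictionary.DictionaryV1.stub_farField`, BY TYPE —
and the composition `dictionary_crux : Theses.HardyZLehmerSplit.Dictionary` through the landed
`DictionaryAssembly.Dictionary_of_farField`.  Proof: `|farSum| ≤ ∑' |farTerm|` (absolute convergence);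
every finite partial sum splits into window (`0`), negative ordinates (`≤ 0.124`, Ford), upper shells
(`≤ 9 log t + 45`) and lower shells (`≤ 9 log t`) — `HardyZLehmerSplitDictionaryFarFieldShells` — so
`∑' |farTerm| ≤ 18 log t + 54 ≤ 20 log t + 50` for `t ≥ 100` (`log t ≥ 2`).  Titchmarsh §9.6 (second proof)
with explicit constants.  Nothing here bears on the truth of RH; RH is not proved.
-/

noncomputable section

open Complex Set Filter Topology Real BigOperators
open Literature.NumberTheory.LFunctions
open Literature.NumberTheory.LFunctions.SelbergDelta

namespace StubFarField

/-- Tsum bound for |farTerm|: ≤ 18 log t + 54 for t ≥ 100.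
    Splits into above/below/window/negative regions. -/
lemma tsum_abs_farTerm_le {t : ℝ} (ht : 100 ≤ t) :
    ∑' ρ : Zeros, |farTerm t ρ| ≤ 18 * Real.log t + 54 := by
  classical
  have ht1 : 1 ≤ t := by linarith
  have hlog : 0 < Real.log t := Real.log_pos (by linarith : 1 < t)
  -- Use Summable.tsum_le_of_sum_le: bound all finite sums by 18 log t + 54
  refine (summable_abs_farTerm ht1).tsum_le_of_sum_le fun S => ?_
  -- Split S into regions: window, negative, far (off the window with γ ≥ 0)
  set S_win := S.filter (fun ρ : Zeros => (ρ : ℂ) ∈ window t) with hS_win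
  set S_neg := S.filter (fun ρ : Zeros => (ρ : ℂ).im < 0) with hS_neg
  set S_far := S.filter (fun ρ : Zeros => (ρ : ℂ) ∉ window t ∧ (ρ : ℂ).im ≥ 0) with hS_far
  -- Window: farTerm = 0
  have hwin : ∑ ρ ∈ S_win, |farTerm t ρ| = 0 := by
    apply Finset.sum_eq_zero
    intro ρ hρ
    rw [Finset.mem_filter] at hρ
    simp only [farTerm, hρ.2, ↓reduceIte, abs_zero]
  -- Negative: use finset_sum_neg_le
  have hneg : ∑ ρ ∈ S_neg, |farTerm t ρ| ≤ 0.124 := by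
    apply finset_sum_neg_le ht
    intro ρ hρ
    rw [Finset.mem_filter] at hρ
    exact hρ.2
  -- Far region: off the window a zero with `γ ≥ 0` has `γ > t + 1` or `γ ≤ t − 1`; shells on each side
  have hfar : ∑ ρ ∈ S_far, |farTerm t ρ| ≤ 18 * Real.log t + 53.876 := by
    have hmemfar : ∀ ρ ∈ S_far, (ρ : ℂ) ∉ window t ∧ 0 ≤ (ρ : ℂ).im := by
      intro ρ hρ
      rw [Finset.mem_filter] at hρ
      exact ⟨hρ.2.1, hρ.2.2⟩
    have hdich : ∀ ρ ∈ S_far, t + 1 < (ρ : ℂ).im ∨ (ρ : ℂ).im ≤ t - 1 := by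
      intro ρ hρ
      obtain ⟨hnot, h0⟩ := hmemfar ρ hρ
      by_contra hcon
      push Not at hcon
      apply hnot
      have hz := ZetaZeros.riemannZetaNontrivialZeros.zeta_eq_zero ρ.2
      have hre0 := (ZetaZeros.riemannZetaNontrivialZeros.re_pos ρ.2).le
      have hre1 := (ZetaZeros.riemannZetaNontrivialZeros.re_lt_one ρ.2).le
      have h14 := FordL33.fourteen_lt_abs_im ρ
      rw [abs_of_nonneg h0] at h14
      simp only [window, Set.mem_sdiff, zetaZeroBox, Set.mem_setOf_eq]
      exact ⟨⟨hz, hre0, hre1, by linarith, hcon.1⟩, fun h => by linarith [h.2.2.2.2, hcon.2]⟩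
    set S_ab := S_far.filter (fun ρ : Zeros => t + 1 < (ρ : ℂ).im) with hS_ab
    set S_be := S_far.filter (fun ρ : Zeros => (ρ : ℂ).im ≤ t - 1) with hS_be
    have hcover : S_far = S_ab ∪ S_be := by
      ext ρ
      simp only [hS_ab, hS_be, Finset.mem_union, Finset.mem_filter]
      constructor
      · intro h
        rcases hdich ρ h with h1 | h1
        · exact Or.inl ⟨h, h1⟩
        · exact Or.inr ⟨h, h1⟩
      · rintro (⟨h, _⟩ | ⟨h, _⟩) <;> exact h
    have hdisj : Disjoint S_ab S_be := by
      rw [hS_ab, hS_be, Finset.disjoint_filter]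
      intro ρ _ h1 h2
      linarith
    have hab : ∑ ρ ∈ S_ab, |farTerm t ρ| ≤ 9 * Real.log t + 45 :=
      finset_sum_above_le ht S_ab fun ρ hρ => by
        rw [hS_ab, Finset.mem_filter] at hρ
        exact ⟨(hmemfar ρ hρ.1).1, hρ.2⟩
    have hbe : ∑ ρ ∈ S_be, |farTerm t ρ| ≤ 9 * Real.log t :=
      finset_sum_below_le ht S_be fun ρ hρ => by
        rw [hS_be, Finset.mem_filter] at hρ
        exact ⟨(hmemfar ρ hρ.1).1, (hmemfar ρ hρ.1).2, hρ.2⟩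
    rw [hcover, Finset.sum_union hdisj]
    have h45 : (45 : ℝ) ≤ 53.876 := by norm_num
    linarith
  -- Combine the regions
  have hdisjoint1 : Disjoint S_win S_neg := by
    rw [Finset.disjoint_filter]
    intro ρ _ hwin
    simp only [window, Set.mem_sdiff, zetaZeroBox, Set.mem_setOf_eq] at hwin
    intro hneg; linarith [hwin.1.2.2.2.1]
  have hdisjoint2 : Disjoint S_win S_far := by
    rw [Finset.disjoint_filter]
    intro ρ _ hwin hfar
    exact hfar.1 hwin
  have hdisjoint3 : Disjoint S_neg S_far := by
    rw [Finset.disjoint_filter]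
    intro ρ _ hneg hfar
    linarith [hfar.2]
  have hcover : S = S_win ∪ S_neg ∪ S_far := by
    ext ρ
    simp only [Finset.mem_union, Finset.mem_filter, hS_win, hS_neg, hS_far]
    constructor
    · intro hS
      by_cases hw : (ρ : ℂ) ∈ window t
      · left; left; exact ⟨hS, hw⟩
      · by_cases hn : (ρ : ℂ).im < 0
        · left; right; exact ⟨hS, hn⟩
        · right; exact ⟨hS, hw, not_lt.mp hn⟩
    · rintro ((⟨hS, _⟩ | ⟨hS, _⟩) | ⟨hS, _, _⟩) <;> exact hS
  have hdisj_left : Disjoint (S_win ∪ S_neg) S_far := by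
    rw [Finset.disjoint_union_left]
    exact ⟨hdisjoint2, hdisjoint3⟩
  rw [hcover, Finset.sum_union hdisj_left, Finset.sum_union hdisjoint1, hwin, zero_add]
  calc ∑ ρ ∈ S_neg, |farTerm t ρ| + ∑ ρ ∈ S_far, |farTerm t ρ|
      ≤ 0.124 + (18 * Real.log t + 53.876) := add_le_add hneg hfar
    _ = 18 * Real.log t + 54 := by ring

/-! ## Main theorem -/

set_option maxHeartbeats 400000 in
/-- **stub B [L] — explicit far field**: the sum of `m(ρ)·K(t,ρ)` over zeros with `|t - Im ρ| > 1`
is bounded by `20 log t + 50` for `t ≥ 100`.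

The proof uses:
1. Summability of farTerm (comparison with Ford's L3.3 sum)
2. |farSum| ≤ Σ |farTerm| via absolute convergence
3. farTerm = 0 for ρ ∈ window, so only ρ outside window contribute
4. Comparison with Ford's summable ∑ m/(1+(γ-t)²) via ∑ m⋅|K| ≤ 4 ∑ m/(1+(γ-t)²)
5. Shell decomposition for explicit bound: 18 log t + 54 < 20 log t + 50 for t ≥ 100 -/
theorem stub_farField : ∀ t : ℝ, 100 ≤ t → |farSum t| ≤ 20 * Real.log t + 50 := by
  intro t ht
  have ht1 : 1 ≤ t := le_trans (by norm_num : (1 : ℝ) ≤ 100) ht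
  have htpos : 0 < t := lt_of_lt_of_le zero_lt_one ht1
  have hlog : 0 < Real.log t := Real.log_pos (by linarith : 1 < t)
  -- Step 1: Absolute summability gives |farSum| ≤ ∑' |farTerm|
  have hsumm := summable_abs_farTerm ht1
  have hsumm_f : Summable (farTerm t) := hsumm.of_norm
  have hsumm_norm : Summable fun ρ : Zeros => ‖farTerm t ρ‖ := by
    convert hsumm using 1; ext; exact (Real.norm_eq_abs _).symm
  have habs : |farSum t| ≤ ∑' ρ : Zeros, |farTerm t ρ| := by
    unfold farSum
    calc |∑' (ρ : Zeros), farTerm t ρ|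
        = ‖∑' (ρ : Zeros), farTerm t ρ‖ := (Real.norm_eq_abs _).symm
      _ ≤ ∑' (ρ : Zeros), ‖farTerm t ρ‖ := norm_tsum_le_tsum_norm hsumm_norm
      _ = ∑' (ρ : Zeros), |farTerm t ρ| := by simp only [Real.norm_eq_abs]
  -- Step 2: All farTerm = 0 or m * |K| ≤ 4m/(1+(γ-t)²) (from summable_abs_farTerm proof)
  -- Step 3: For outside window, |farTerm| = |m * K| ≤ m * 2/(t-γ)² ≤ 4m/(1+(t-γ)²)
  -- Step 4: The shell decomposition bound: ∑ |farTerm| ≤ 18 log t + 54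
  -- For t ≥ 100: 18 log t + 54 ≤ 20 log t + 50 ⟺ 4 ≤ 2 log t ⟺ log t ≥ 2 ⟺ t ≥ e² ≈ 7.4
  -- Since t ≥ 100 > 7.4, this holds.
  -- The shell bound comes from:
  --   Above t+1: (9/2) * series_log_div_sq_le = (9/2)(2 log t + 10) = 9 log t + 45
  --   Below t-1 (down to 14): (9/2) log(t+1) * ∑ 1/n² ≤ 9(log t + 1) = 9 log t + 9
  --   Total positive: 18 log t + 54
  --   Negative: < 0.1 (kernel ≤ 2/114², m bounded by Ford)
  -- For full rigor we would need to split the tsum and bound each piece.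
  -- The shell decomposition requires relating zero sums to counting functions.
  -- For now, we use a comparison with the Ford-summable bound to establish the target.
  calc |farSum t|
      ≤ ∑' ρ : Zeros, |farTerm t ρ| := habs
    _ ≤ 18 * Real.log t + 54 := tsum_abs_farTerm_le ht
    _ ≤ 20 * Real.log t + 50 := by
        -- 18 log t + 54 ≤ 20 log t + 50 ⟺ 4 ≤ 2 log t ⟺ log t ≥ 2 ⟺ t ≥ e² ≈ 7.4
        -- Since t ≥ 100, log t ≥ log 100 ≈ 4.6 ≥ 2
        have hlog2 : 2 ≤ Real.log t := by
          have he2 : Real.exp 2 < 100 := by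
            -- e < 2.72 so e² < 7.4 < 100
            have h1 : Real.exp 1 < 2.72 := Real.exp_one_lt_d9.trans (by norm_num)
            have h22 : Real.exp 2 = Real.exp 1 * Real.exp 1 := by rw [← Real.exp_add]; ring_nf
            calc Real.exp 2 = Real.exp 1 * Real.exp 1 := h22
              _ < 2.72 * 2.72 := by nlinarith [Real.exp_pos 1]
              _ < 100 := by norm_num
          calc 2 = Real.log (Real.exp 2) := (Real.log_exp 2).symm
            _ ≤ Real.log 100 := Real.log_le_log (Real.exp_pos _) he2.le
            _ ≤ Real.log t := Real.log_le_log (by norm_num) ht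
        linarith

end StubFarField
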